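import Summits.ABC.ABC.Theorems.TwistAmplificationSharpModerateLawUnitPlaneFlat6Defs
import Summits.ABC.ABC.Theorems.TwistAmplificationSharpModerateLawHallCalibration

/-!
# Crux `TwistAmplification.SharpModerateLaw` (stmt-ABC-1975), line `unit-plane-conic-two-torsion`:
calibration of the open Hall corner `stub_cornerHall` — lemmas (a cell of strong Hall near-misses injects into
the Hall-corner data)

Support for `strongHallCount_of_cornerHallLaw : CornerHallLaw6 → StrongHallCount`
(`…SharpModerateLawCornerHallCalibration.lean`; objects of `…SharpModerateLawUnitPlaneFlat6Defs.lean`). Main theorem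
(registered sub-goal `hallCell_le_totalCount` of stmt-ABC-1975): for `U ≥ 3`, `W ≥ 0`, `U³ ≤ 2W³`, the cell
`{(u, v) : 0 < u < U, W ≤ u, u squarefree, (u, 6) = 1, u³ ≠ v², 72|u³ − v²| ≤ √u}` of strong Hall near-misses has
at most `totalCount (CornerHallTw ε) (72√U) (186624·72⁶U³/2)` elements, for every `ε`.

Proof. SCALING `q = (u, v) ↦ x = (72²u, 72³v) = (5184u, 373248v)` (injective): `x.1³ − x.2² = 72⁶(u³ − v²)`,
`(x.1³ − x.2²)/1728 = 2¹²3⁹(u³ − v²)`, `x` is tower-free (the sibling line's `CuspDispersion.tf_scale`,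
`…HallCalibration.lean`), `Mcusp x = 72⁶u³` (`mcusp_scale`, as `|u³ − v²| ≤ u³`), and `N5cusp x ≤ |u³ − v²|`
(`n5cusp_scale_le`: a prime `p ≥ 5` of `Δ` charged `p²` divides `72²u`, hence `u`, hence `v`, hence `p² ∣ u³ − v²`;
then `prod_prime_pow_dvd`). CELL: for `W ≤ u < U`, `U³ ≤ 2W³`, the pair `x` lies in `cuspShell X Y_c`, `X = 72√U`,
`Y_c = 72⁶U³/2` (`scale_mem_cuspShell`: `Y_c ≤ 72⁶u³ < 2Y_c`, `N5cusp x ≤ √u/72 ≤ X`). DICTIONARY: the injection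
`x ↦ (D, O, q)` of `ncard_cuspShell_le` (`…SyzygyTransfer.lean`) restricted to a predicate (`ncard_cuspShell_sep_le`)
lands in index-form data `(F, q)` at level `Y = 186624·Y_c` with `Disc F·F(q)² = 108(x.1³ − x.2²)`
(`exists_indexFormData`, `mem_ifShell_of_data`), and such a datum is in the Hall corner (`cornerHallTw_of_data`:
`|Disc F|·m²·g³ ≤ |Disc F|·m²·g⁶ = |Disc F·F(q)²| = 108·72⁶|u³ − v²| ≤ 108·72⁵√U ≤ 432·√(2Y) = (72⁶/2)·U√U` as
`U ≥ 3`).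
-/

noncomputable section

-- the mandated summit namespace `Summit.ABC.ABC` (summit = problem) trips the duplicate-namespace linter
set_option linter.dupNamespace false

namespace Summit.ABC.ABC.Theorems.SharpModerateLaw.UnitPlane

open Literature.NumberTheory.CubicFields
open scoped BigOperators

/-! ## 1. The dictionary injection restricted to a predicate -/

/-- The counted `P`-slice of the shell of an orbit representative of discriminant `D ≠ 0` is finite. -/
private theorem shellSetP_finite {D : ℤ} (hD : D ≠ 0) (O : orbitsOfDisc D)
    (P : ℝ → ℝ → BinaryCubic ℤ → ℤ × ℤ → Prop) (X Y : ℝ) :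
    {q : ℤ × ℤ | RingOfForm.IsMaximal (orbitRep O) ∧ q ∈ ifShell (orbitRep O) X Y ∧ P X Y (orbitRep O) q}.Finite := by
  refine (finite_mplus_le (orbitRep O) (by rw [(orbitRep_spec O).2]; exact hD) ⌈2 * Y⌉₊).subset ?_
  rintro q ⟨-, hq, -⟩
  exact_mod_cast (show (Mplus (orbitRep O) q : ℝ) ≤ ⌈2 * Y⌉₊ from (le_of_lt hq.2.2.2.2.2.1).trans (Nat.le_ceil _))

/-- **The dictionary injection restricted to a predicate** (variant of `ncard_cuspShell_le`): if every index-form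
datum `(F, q)` (`F` maximal, `H_F(q) = 9c₄`, `G_F(q) = −54c₆`, `Disc F·F(q)² = 108(c₄³ − c₆²)`) attached to a cusp pair
`x = (c₄, c₆) ∈ cuspShell X Y` with `R x` satisfies `P` at `(X, 186624·Y)`, then
`#{x ∈ cuspShell X Y | R x} ≤ totalCount P X (186624·Y)` (the map `x ↦ (D, O, q)` is injective: `x` is read off
from `H_F(q), G_F(q)`). -/
theorem ncard_cuspShell_sep_le (R : ℤ × ℤ → Prop) (P : ℝ → ℝ → BinaryCubic ℤ → ℤ × ℤ → Prop) (X Y : ℝ)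
    (hRP : ∀ x ∈ cuspShell X Y, R x → ∀ (F : BinaryCubic ℤ) (q : ℤ × ℤ), RingOfForm.IsMaximal F →
      hessAt F q.1 q.2 = 9 * x.1 → covAt F q.1 q.2 = -54 * x.2 →
      F.disc * F.eval q.1 q.2 ^ 2 = 108 * (x.1 ^ 3 - x.2 ^ 2) → P X (186624 * Y) F q) :
    {x | x ∈ cuspShell X Y ∧ R x}.ncard ≤ totalCount P X (186624 * Y) := by
  classical
  set Y' : ℝ := 186624 * Y with hY'
  choose D O q hspec using exists_indexFormData
  -- `Finset` models of the orbits of discriminant `D ≠ 0` and of the counted `P`-slices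
  obtain ⟨orbFin, horb⟩ : ∃ f : (D : ℤ) → Finset (orbitsOfDisc D), ∀ D, D ≠ 0 → ∀ O, O ∈ f D :=
    ⟨fun D => if hD : D = 0 then ∅ else (@Set.finite_univ (orbitsOfDisc D) (finite_orbitsOfDisc hD)).toFinset,
      fun D hD O => by simp only [dif_neg hD, Set.Finite.mem_toFinset, Set.mem_univ]⟩
  obtain ⟨shellFin, hcard, hmemS⟩ : ∃ g : (D : ℤ) → orbitsOfDisc D → Finset (ℤ × ℤ),
      (∀ D, D ≠ 0 → ∀ O, shellCount P X Y' (orbitRep O) = (g D O).card) ∧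
      (∀ D (_ : D ≠ 0) O q, RingOfForm.IsMaximal (orbitRep O) → q ∈ ifShell (orbitRep O) X Y' →
        P X Y' (orbitRep O) q → q ∈ g D O) :=
    ⟨fun D O => if hD : D = 0 then ∅ else (shellSetP_finite hD O P X Y').toFinset,
      fun D hD O => by simp only [dif_neg hD]; exact Set.ncard_eq_toFinset_card _ (shellSetP_finite hD O P X Y'),
      fun D hD O q h1 h2 h3 => by simp only [dif_neg hD, Set.Finite.mem_toFinset]; exact ⟨h1, h2, h3⟩⟩
  let U : Finset (Σ D : ℤ, Σ _ : orbitsOfDisc D, ℤ × ℤ) :=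
    ((Finset.Icc (-(⌈2 * Y'⌉₊ : ℤ)) (⌈2 * Y'⌉₊ : ℤ)).erase 0).sigma fun D => (orbFin D).sigma fun O => shellFin D O
  have hU : U.card = totalCount P X Y' := by
    rw [Finset.card_sigma]; unfold totalCount
    refine Finset.sum_congr rfl fun D hD => ?_
    have hD0 : D ≠ 0 := (Finset.mem_erase.mp hD).1
    rw [Finset.card_sigma]; unfold orbitTotal
    rw [finsum_eq_finsetSum_of_support_subset _ (fun O _ => Finset.mem_coe.mpr (horb D hD0 O))]
    exact Finset.sum_congr rfl fun O _ => (hcard D hD0 O).symm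
  let Φ : ℤ × ℤ → (Σ D : ℤ, Σ _ : orbitsOfDisc D, ℤ × ℤ) := fun x => ⟨D x, O x, q x⟩
  have hmem : ∀ x ∈ {x | x ∈ cuspShell X Y ∧ R x}, Φ x ∈ (U : Set _) := by
    rintro x ⟨hx, hR⟩
    obtain ⟨hmax, hH, hG, hDF⟩ := hspec x hx.2.2.1
    have hdisc : (orbitRep (O x)).disc = D x := (orbitRep_spec (O x)).2
    have hq : q x ∈ ifShell (orbitRep (O x)) X Y' := mem_ifShell_of_data hx hH hG hDF
    have hD0 : D x ≠ 0 := by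
      rw [← hdisc]; refine left_ne_zero_of_mul (b := (orbitRep (O x)).eval (q x).1 (q x).2 ^ 2) ?_
      rw [hDF]; exact mul_ne_zero (by norm_num) (sub_ne_zero.mpr hx.2.2.1)
    have hDle : (D x).natAbs ≤ ⌈2 * Y'⌉₊ := by
      have hlt : (Mplus (orbitRep (O x)) (q x) : ℝ) < 2 * Y' := hq.2.2.2.2.2.1
      have hM : Mplus (orbitRep (O x)) (q x) ≤ ⌈2 * Y'⌉₊ := by exact_mod_cast hlt.le.trans (Nat.le_ceil _)
      refine le_trans ?_ ((le_max_left _ _).trans hM)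
      rw [show (D x).natAbs = (orbitRep (O x)).disc.natAbs by rw [hdisc], Int.natAbs_mul, Int.natAbs_pow]
      exact Nat.le_mul_of_pos_right _ (pow_pos (Int.natAbs_pos.mpr hq.1) 2)
    refine Finset.mem_coe.mpr (Finset.mem_sigma.mpr ⟨?_, Finset.mem_sigma.mpr
      ⟨horb _ hD0 _, hmemS _ hD0 _ _ hmax hq (hRP x hx hR _ _ hmax hH hG hDF)⟩⟩)
    refine Finset.mem_erase.mpr ⟨hD0, Finset.mem_Icc.mpr (abs_le.mp ?_)⟩
    rw [← Int.natCast_natAbs]; exact_mod_cast hDle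
  have hinj : Set.InjOn Φ {x | x ∈ cuspShell X Y ∧ R x} := by
    rintro x₁ ⟨hx₁, -⟩ x₂ ⟨hx₂, -⟩ h
    obtain ⟨-, hH₁, hG₁, -⟩ := hspec x₁ hx₁.2.2.1
    obtain ⟨-, hH₂, hG₂, -⟩ := hspec x₂ hx₂.2.2.1
    have h' : (orbitRep (O x₁), q x₁) = (orbitRep (O x₂), q x₂) :=
      congrArg (fun s : (Σ D : ℤ, Σ _ : orbitsOfDisc D, ℤ × ℤ) => (orbitRep s.2.1, s.2.2)) h
    obtain ⟨hF, hq⟩ := Prod.mk.inj h'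
    rw [hF, hq] at hH₁ hG₁
    exact Prod.ext (by linarith) (by linarith)
  calc {x | x ∈ cuspShell X Y ∧ R x}.ncard
      ≤ (U : Set _).ncard := Set.ncard_le_ncard_of_injOn Φ hmem hinj (Finset.finite_toSet U)
    _ = U.card := Set.ncard_coe_finset U
    _ = totalCount P X Y' := hU

/-! ## 2. The scaled pair `(72²u, 72³v)`: level, conductor proxy, membership -/

/-- `x.1³ − x.2² = 72⁶(u³ − v²)` for `x = (72²u, 72³v)`. -/
theorem cusp_scale_sub (u v : ℤ) : (5184 * u) ^ 3 - (373248 * v) ^ 2 = 139314069504 * (u ^ 3 - v ^ 2) := by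
  ring

/-- `(x.1³ − x.2²)/1728 = 2¹²3⁹(u³ − v²)` exactly. -/
theorem cusp_scale_ediv (u v : ℤ) : ((5184 * u) ^ 3 - (373248 * v) ^ 2) / 1728 = 80621568 * (u ^ 3 - v ^ 2) := by
  rw [show (5184 * u) ^ 3 - (373248 * v) ^ 2 = 1728 * (80621568 * (u ^ 3 - v ^ 2)) by ring]
  exact Int.mul_ediv_cancel_left _ (by norm_num)

/-- A prime dividing `u` and `u³ − v²` divides `v`, so its square divides `u³ − v²`. -/
theorem sq_dvd_cube_sub_sq {p u v : ℤ} (hp : Prime p) (hu : p ∣ u) (hd : p ∣ u ^ 3 - v ^ 2) :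
    p ^ 2 ∣ u ^ 3 - v ^ 2 := by
  have hu3 : p ∣ u ^ 3 := dvd_pow hu (by norm_num)
  have hv2 : p ∣ v ^ 2 := by
    have h := dvd_sub hu3 hd
    rwa [sub_sub_cancel] at h
  have hv : p ∣ v := hp.dvd_of_dvd_pow hv2
  exact dvd_sub ((pow_dvd_pow p (by norm_num : 2 ≤ 3)).trans (pow_dvd_pow_of_dvd hu 3)) (pow_dvd_pow_of_dvd hv 2)

/-- A prime `≥ 5` does not divide `2^a·3^b`-type constants: here `5184 = 2⁶3⁴` and `80621568 = 2¹²3⁹`. -/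
private theorem not_dvd_of_five_le {p : ℕ} (hp : p.Prime) (h5 : 5 ≤ p) {a b : ℕ} : ¬ p ∣ 2 ^ a * 3 ^ b := by
  intro h
  rcases (Nat.Prime.dvd_mul hp).mp h with h2 | h3
  · have := (Nat.prime_dvd_prime_iff_eq hp Nat.prime_two).mp (hp.dvd_of_dvd_pow h2); omega
  · have := (Nat.prime_dvd_prime_iff_eq hp Nat.prime_three).mp (hp.dvd_of_dvd_pow h3); omega

/-- **Conductor proxy of the scaled pair**: `N5cusp (72²u, 72³v) ≤ |u³ − v²|`. The primes `p ≥ 5` of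
`Δ = 2¹²3⁹(u³ − v²)` are those of `u³ − v²`; one charged `p²` divides `72²u`, hence `u`, hence (`sq_dvd_cube_sub_sq`)
`p² ∣ u³ − v²`; so the whole product divides `|u³ − v²|` (`prod_prime_pow_dvd`). -/
theorem n5cusp_scale_le {u v : ℤ} (hD : u ^ 3 - v ^ 2 ≠ 0) :
    N5cusp (5184 * u, 373248 * v) ≤ (u ^ 3 - v ^ 2).natAbs := by
  unfold N5cusp
  simp only
  rw [cusp_scale_ediv, Int.natAbs_mul]
  set d : ℕ := (u ^ 3 - v ^ 2).natAbs with hd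
  have hd0 : d ≠ 0 := Int.natAbs_ne_zero.mpr hD
  rw [show (80621568 : ℤ).natAbs = 80621568 from rfl]
  refine Nat.le_of_dvd (Nat.pos_of_ne_zero hd0) ?_
  have hconv : ∀ p ∈ ((80621568 * d).primeFactors.filter fun p => 5 ≤ p),
      (if ((p : ℕ) : ℤ) ∣ 5184 * u then p ^ 2 else p) = p ^ (if ((p : ℕ) : ℤ) ∣ 5184 * u then 2 else 1) := by
    intro p _
    split_ifs <;> simp
  rw [Finset.prod_congr rfl hconv]
  refine Literature.NumberTheory.EllipticCurves.SzpiroOfAbc.prod_prime_pow_dvd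
    (fun p hp => Nat.prime_of_mem_primeFactors (Finset.mem_filter.mp hp).1) _ fun p hp => ?_
  obtain ⟨hpF, h5⟩ := Finset.mem_filter.mp hp
  have hpp : p.Prime := Nat.prime_of_mem_primeFactors hpF
  have hpd : p ∣ d := by
    rcases (Nat.Prime.dvd_mul hpp).mp (Nat.dvd_of_mem_primeFactors hpF) with h1 | h1
    · exact absurd (show p ∣ 2 ^ 12 * 3 ^ 9 by norm_num; exact h1) (not_dvd_of_five_le hpp h5)
    · exact h1
  split_ifs with hc
  · have hpZ : Prime (p : ℤ) := Nat.prime_iff_prime_int.mp hpp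
    have hndvd : ¬ (p : ℤ) ∣ 5184 := fun hdv =>
      not_dvd_of_five_le hpp h5 (show p ∣ 2 ^ 6 * 3 ^ 4 by norm_num; exact_mod_cast hdv)
    have hpu : (p : ℤ) ∣ u := (hpZ.dvd_or_dvd hc).resolve_left hndvd
    have hpd' : (p : ℤ) ∣ u ^ 3 - v ^ 2 := Int.ofNat_dvd_left.mpr hpd
    have h2 := Int.natAbs_dvd_natAbs.mpr (sq_dvd_cube_sub_sq hpZ hpu hpd')
    simpa [Int.natAbs_pow] using h2
  · simpa using hpd

/-- **Level of the scaled pair**: `Mcusp (72²u, 72³v) = 72⁶u³` when `0 < u` and `|u³ − v²| ≤ u³`. -/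
theorem mcusp_scale {u v : ℤ} (hu : 0 < u) (hd : |u ^ 3 - v ^ 2| ≤ u ^ 3) :
    ((Mcusp (5184 * u, 373248 * v) : ℕ) : ℝ) = 139314069504 * (u : ℝ) ^ 3 := by
  have hZ : ((Mcusp (5184 * u, 373248 * v) : ℕ) : ℤ) = 139314069504 * u ^ 3 := by
    unfold Mcusp
    simp only
    rw [cusp_scale_ediv, Nat.cast_max, Nat.cast_pow, Int.natCast_natAbs, Int.natCast_natAbs, abs_mul,
      abs_of_pos (by positivity : (0 : ℤ) < 5184 * u), abs_of_pos (by norm_num : (0 : ℤ) < 80621568),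
      max_eq_right (by nlinarith [pow_pos hu 3])]
    ring
  have h : ((Mcusp (5184 * u, 373248 * v) : ℕ) : ℝ) = (((Mcusp (5184 * u, 373248 * v) : ℕ) : ℤ) : ℝ) := by simp
  rw [h, hZ]; push_cast; ring

/-- **Membership.** For `u > 0` squarefree and prime to `6`, `u³ ≠ v²`, `72|u³ − v²| ≤ √u`, and a scale `U`
with `u < U`, `U³ ≤ 2u³`, the scaled pair `(72²u, 72³v)` lies in `cuspShell (72√U) (72⁶U³/2)`: `c₄c₆ ≠ 0`
(`v = 0` would give `72u³ ≤ √u`), `Δ ≠ 0`, `1728 ∣ 72⁶(u³ − v²)`, tower-free (`tf_scale`), level `72⁶u³ ∈ [Y, 2Y)`,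
and `N5cusp ≤ |u³ − v²| ≤ √u ≤ 72√U`. -/
theorem scale_mem_cuspShell {u v : ℤ} {U : ℝ} (hu : 0 < u) (hsq : Squarefree u) (hcop : IsCoprime u 6)
    (hne : u ^ 3 ≠ v ^ 2) (hhall : (72 * |u ^ 3 - v ^ 2| : ℝ) ≤ Real.sqrt u)
    (huU : (u : ℝ) < U) (hUu : U ^ 3 ≤ 2 * (u : ℝ) ^ 3) :
    ((5184 * u, 373248 * v) : ℤ × ℤ) ∈ cuspShell (72 * Real.sqrt U) (69657034752 * U ^ 3) := by
  simp only [cuspShell, Set.mem_setOf_eq]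
  have hu1 : (1 : ℝ) ≤ u := by exact_mod_cast hu
  have hu0 : (0 : ℝ) ≤ u := by linarith
  have hsqrt_u : Real.sqrt (u : ℝ) ≤ u := by rw [Real.sqrt_le_left hu0]; nlinarith
  have hu3 : (u : ℝ) ≤ (u : ℝ) ^ 3 := le_self_pow₀ hu1 (by norm_num)
  have hhall' : 72 * |(u : ℝ) ^ 3 - (v : ℝ) ^ 2| ≤ Real.sqrt u := by exact_mod_cast hhall
  have ha0 : 0 ≤ |(u : ℝ) ^ 3 - (v : ℝ) ^ 2| := abs_nonneg _
  have hau : |(u : ℝ) ^ 3 - (v : ℝ) ^ 2| ≤ u := by linarith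
  have hdZ : |u ^ 3 - v ^ 2| ≤ u ^ 3 := by
    have h : |(u : ℝ) ^ 3 - (v : ℝ) ^ 2| ≤ (u : ℝ) ^ 3 := hau.trans hu3
    exact_mod_cast h
  have hv0 : v ≠ 0 := by
    rintro rfl
    have h : |(u : ℝ) ^ 3 - ((0 : ℤ) : ℝ) ^ 2| = (u : ℝ) ^ 3 := by
      rw [Int.cast_zero, show (u : ℝ) ^ 3 - (0 : ℝ) ^ 2 = (u : ℝ) ^ 3 by ring, abs_of_nonneg (by positivity)]
    rw [h] at hhall'
    nlinarith
  have hD0 : u ^ 3 - v ^ 2 ≠ 0 := sub_ne_zero.mpr hne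
  have hM := mcusp_scale (v := v) hu hdZ
  refine ⟨(by positivity : (0 : ℤ) < 5184 * u).ne', mul_ne_zero (by norm_num) hv0, ?_,
    ⟨80621568 * (u ^ 3 - v ^ 2), by ring⟩, CuspDispersion.tf_scale v hsq hcop, ?_, ?_, ?_⟩
  · intro h
    apply hD0
    have h0 : (139314069504 : ℤ) * (u ^ 3 - v ^ 2) = 0 := by rw [← cusp_scale_sub, h, sub_self]
    simpa using h0
  · rw [hM]; nlinarith
  · rw [hM]
    have h3 : (u : ℝ) ^ 3 < U ^ 3 := pow_lt_pow_left₀ huU hu0 three_ne_zero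
    nlinarith
  · have h1 : ((N5cusp (5184 * u, 373248 * v) : ℕ) : ℝ) ≤ |(u : ℝ) ^ 3 - (v : ℝ) ^ 2| := by
      have h := (Nat.cast_le (α := ℝ)).mpr (n5cusp_scale_le (v := v) hD0)
      push_cast [Nat.cast_natAbs] at h
      exact h
    have h2 : Real.sqrt (u : ℝ) ≤ Real.sqrt U := Real.sqrt_le_sqrt huU.le
    have h3 : 0 ≤ Real.sqrt U := Real.sqrt_nonneg U
    linarith

/-! ## 3. The image datum is in the Hall corner; the cell injection -/

/-- **The image datum is Hall at its own level.** If `Disc F·F(q)² = 108·(x.1³ − x.2²)` for the scaled pair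
`x = (72²u, 72³v)` of a strong Hall near-miss (`72|u³ − v²| ≤ √u`, `0 < u ≤ U`, `U ≥ 3`), then
`|Disc F|·m²·g³ ≤ |Disc F|·m²·g⁶ = |Disc F·F(q)²| = 108·72⁶|u³ − v²| ≤ 108·72⁵·√U ≤ 432·√(2Y)`, `Y = 186624·72⁶U³/2`
(`√(2Y) = 2¹³3⁹·U√U`, and `108·72⁵ = 3·(72⁶/2)`). -/
theorem cornerHallTw_of_data {u v : ℤ} {U : ℝ} (ε X : ℝ) (hu : 0 < u)
    (hhall : (72 * |u ^ 3 - v ^ 2| : ℝ) ≤ Real.sqrt u) (hU : 3 ≤ U) (huU : (u : ℝ) ≤ U)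
    {F : BinaryCubic ℤ} {q : ℤ × ℤ}
    (hDF : F.disc * F.eval q.1 q.2 ^ 2 = 108 * ((5184 * u) ^ 3 - (373248 * v) ^ 2)) :
    CornerHallTw ε X (186624 * (69657034752 * U ^ 3)) F q := by
  unfold CornerHallTw
  set g : ℕ := Int.gcd q.1 q.2 with hg
  have hU0 : 0 ≤ U := by linarith
  have hu0 : (0 : ℝ) ≤ u := by exact_mod_cast hu.le
  have hhall' : 72 * |(u : ℝ) ^ 3 - (v : ℝ) ^ 2| ≤ Real.sqrt u := by exact_mod_cast hhall
  have hsU : Real.sqrt (u : ℝ) ≤ Real.sqrt U := Real.sqrt_le_sqrt huU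
  -- `|Disc F|·m²·g⁶ = |Disc F·F(q)²|`
  have h1 : (g : ℤ) * (q.1 / (g : ℤ)) = q.1 := Int.mul_ediv_cancel' (Int.gcd_dvd_left _ _)
  have h2 : (g : ℤ) * (q.2 / (g : ℤ)) = q.2 := Int.mul_ediv_cancel' (Int.gcd_dvd_right _ _)
  have e : F.eval q.1 q.2 = (g : ℤ) ^ 3 * F.eval (q.1 / (g : ℤ)) (q.2 / (g : ℤ)) := by
    rw [← FewDeepSlice.eval_smul', h1, h2]
  have hn : (F.disc * F.eval q.1 q.2 ^ 2).natAbs = F.disc.natAbs * (g ^ 3 * primValue F q) ^ 2 := by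
    rw [Int.natAbs_mul, Int.natAbs_pow, e, Int.natAbs_mul, Int.natAbs_pow, Int.natAbs_natCast]; rfl
  have hprim : (F.disc.natAbs : ℝ) * (primValue F q : ℝ) ^ 2 * (g : ℝ) ^ 6 =
      ((F.disc * F.eval q.1 q.2 ^ 2).natAbs : ℝ) := by
    rw [hn]; push_cast; ring
  have hDF' : ((F.disc * F.eval q.1 q.2 ^ 2).natAbs : ℝ) = 108 * 139314069504 * |(u : ℝ) ^ 3 - (v : ℝ) ^ 2| := by
    rw [Nat.cast_natAbs, hDF, cusp_scale_sub]; push_cast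
    rw [abs_mul, abs_mul, abs_of_pos (by norm_num : (0 : ℝ) < 108), abs_of_pos (by norm_num : (0 : ℝ) < 139314069504)]
    ring
  have hg36 : (g : ℝ) ^ 3 ≤ (g : ℝ) ^ 6 := by
    rcases Nat.eq_zero_or_pos g with h0 | hpos
    · simp [h0]
    · exact pow_le_pow_right₀ (by exact_mod_cast hpos) (by norm_num)
  have hY : 2 * (186624 * (69657034752 * U ^ 3)) = (161243136 * U * Real.sqrt U) ^ 2 := by
    rw [mul_pow, mul_pow, Real.sq_sqrt hU0]; ring
  rw [hY, Real.sqrt_sq (by positivity)]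
  have hDm : 0 ≤ (F.disc.natAbs : ℝ) * (primValue F q : ℝ) ^ 2 := by positivity
  calc (F.disc.natAbs : ℝ) * (primValue F q : ℝ) ^ 2 * (g : ℝ) ^ 3
      ≤ (F.disc.natAbs : ℝ) * (primValue F q : ℝ) ^ 2 * (g : ℝ) ^ 6 := mul_le_mul_of_nonneg_left hg36 hDm
    _ = 108 * 139314069504 * |(u : ℝ) ^ 3 - (v : ℝ) ^ 2| := by rw [hprim, hDF']
    _ ≤ 208971104256 * Real.sqrt U := by linarith
    _ ≤ 432 * (161243136 * U * Real.sqrt U) := by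
        nlinarith [mul_nonneg (Real.sqrt_nonneg U) (sub_nonneg.mpr hU)]

/-- **A cell of strong Hall near-misses injects into the Hall-corner data** (registered sub-goal
`hallCell_le_totalCount` of stmt-ABC-1975, the main theorem of this file): for `U ≥ 3`, `W ≥ 0`, `U³ ≤ 2W³` and every
`ε`, `#{(u, v) : 0 < u < U, …, 72|u³ − v²| ≤ √u, W ≤ u} ≤ totalCount (CornerHallTw ε) (72√U) (186624·72⁶U³/2)`:
`(u, v) ↦ (72²u, 72³v)` is injective into the image pairs of `cuspShell (72√U) (72⁶U³/2)` (`scale_mem_cuspShell`, a finite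
set by `cuspShell_finite`), which inject into the Hall-corner data (`ncard_cuspShell_sep_le`, `cornerHallTw_of_data`). -/
theorem hallCell_le_totalCount : ∀ (ε U W : ℝ), 3 ≤ U → 0 ≤ W → U ^ 3 ≤ 2 * W ^ 3 → Set.ncard {q : ℤ × ℤ | (0 < q.1 ∧ (q.1 : ℝ) < U ∧ Squarefree q.1 ∧ IsCoprime q.1 6 ∧ q.1 ^ 3 ≠ q.2 ^ 2 ∧ (72 * |q.1 ^ 3 - q.2 ^ 2| : ℝ) ≤ Real.sqrt q.1) ∧ W ≤ (q.1 : ℝ)} ≤ totalCount (CornerHallTw ε) (72 * Real.sqrt U) (186624 * (69657034752 * U ^ 3)) := by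
  intro ε U W hU hW hUW
  -- the cell injects into the image pairs of the cusp shell
  have h1 : Set.ncard {q : ℤ × ℤ | (0 < q.1 ∧ (q.1 : ℝ) < U ∧ Squarefree q.1 ∧ IsCoprime q.1 6 ∧
        q.1 ^ 3 ≠ q.2 ^ 2 ∧ (72 * |q.1 ^ 3 - q.2 ^ 2| : ℝ) ≤ Real.sqrt q.1) ∧ W ≤ (q.1 : ℝ)} ≤
      Set.ncard {x : ℤ × ℤ | x ∈ cuspShell (72 * Real.sqrt U) (69657034752 * U ^ 3) ∧
        ∃ q : ℤ × ℤ, (0 < q.1 ∧ (q.1 : ℝ) ≤ U ∧ (72 * |q.1 ^ 3 - q.2 ^ 2| : ℝ) ≤ Real.sqrt q.1) ∧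
          x = (5184 * q.1, 373248 * q.2)} := by
    refine Set.ncard_le_ncard_of_injOn (fun q : ℤ × ℤ => ((5184 * q.1, 373248 * q.2) : ℤ × ℤ))
      ?_ ?_ ((cuspShell_finite _ _).subset fun x hx => hx.1)
    · rintro ⟨u, v⟩ ⟨⟨hu, huU, hsq, hcop, hne, hh⟩, hlow⟩
      refine ⟨scale_mem_cuspShell hu hsq hcop hne hh huU ?_, (u, v), ⟨hu, huU.le, hh⟩, rfl⟩
      have h := pow_le_pow_left₀ hW hlow 3
      simp only at h
      linarith
    · rintro ⟨u, v⟩ - ⟨u', v'⟩ - h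
      simp only [Prod.mk.injEq] at h
      obtain ⟨h1, h2⟩ := h
      simp only [Prod.mk.injEq]
      constructor <;> omega
  -- the image pairs inject into the Hall-corner data (the dictionary)
  refine h1.trans (ncard_cuspShell_sep_le _ (CornerHallTw ε) _ _ ?_)
  rintro x - ⟨⟨u, v⟩, ⟨hu, huU, hh⟩, rfl⟩ F q - - - hDF
  exact cornerHallTw_of_data ε _ hu hh hU huU hDF

end Summit.ABC.ABC.Theorems.SharpModerateLaw.UnitPlane

end
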